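import Literature.Geometry.Riemannian.RadialBilinearForm
import Mathlib.Analysis.SpecialFunctions.SmoothTransition
import HarnessLib

/-!
# The polar metric of the interior surgery: prescribed collar, flat centre

Topic `Geometry/Riemannian`. The metric of Weinstein's disk after surgery (Weinstein 1968, proof of
the main theorem, step (3): "a metric on the disk for which the geodesics from the centre reach the
boundary orthogonally, all at the same time") is, in the polar chart `F` of `UnwindingMap.lean`,
a polar field `P = polarBilin K` (`RadialBilinearForm.lean`) whose tangential part `K`
interpolates between the pulled-back ambient metric `B = F^* g̃` on the collar
`{1-δ ≤ ‖v‖ < 1+δ}` (where `B` is already radial: Gauss lemma for the cone map) and the inner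
product near the centre:

* `exists_surgeryPolarMetric` — for `B` smooth, symmetric, positive definite on the ball
  `B(0, 1+δ)` and radial on the collar, **there is a field `P` on the ball, `C^∞`, symmetric,
  positive definite, radial everywhere (`P_v(v, v) = ‖v‖²`, `P_v(v, β) = 0` for `β ⊥ v`), equal to
  `B` on the collar and to the inner product on `B(0, 1/2)`.**

## References

* A. Weinstein, Ann. of Math. (2) 87 (1968), 29–41, proof of the main theorem, step (3).
  [cite: Weinstein1968]
* J. M. Lee, *Introduction to Riemannian Manifolds*, 2nd ed. (2018), Thm. 6.9, Cor. 6.10.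
  [cite: LeeRiemannianManifolds2018, Thm. 6.9]

Tags: [PolarMetric] [Surgery] [Weinstein1968]
-/

noncomputable section

open Set Function Metric Filter Real
open scoped Topology RealInnerProductSpace ContDiff

namespace Literature.Geometry.Riemannian

variable {V : Type*} [NormedAddCommGroup V] [InnerProductSpace ℝ V] [FiniteDimensional ℝ V]

/-- **Local smoothness of the polar field**: if `K` is `C^n` on an open set `s` of nonzero vectors,
so is `polarBilin K`. (As `contDiffOn_polarBilin`, on `s`.) [folklore] -/
theorem contDiffOn_polarBilin_of_subset {n : WithTop ℕ∞} {K : V → V →L[ℝ] V →L[ℝ] ℝ} {s : Set V}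
    (hs : s ⊆ {v | v ≠ 0}) (hK : ContDiffOn ℝ n K s) : ContDiffOn ℝ n (polarBilin K) s := by
  rw [contDiffOn_clm_apply]
  intro a
  rw [contDiffOn_clm_apply]
  intro b
  have h3 : ContDiffOn ℝ n (fun v : V ↦ (‖v‖ ^ 2)⁻¹) s := by
    refine (contDiff_norm_sq ℝ (n := n)).contDiffOn.inv fun v hv ↦ ?_
    exact pow_ne_zero 2 (norm_ne_zero_iff.2 (hs hv))
  have ha : ContDiffOn ℝ n (fun v : V ↦ ⟪v, a⟫) s := contDiffOn_id.inner ℝ contDiffOn_const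
  have hb : ContDiffOn ℝ n (fun v : V ↦ ⟪v, b⟫) s := contDiffOn_id.inner ℝ contDiffOn_const
  have hrad : ContDiffOn ℝ n (fun v : V ↦ (‖v‖ ^ 2)⁻¹ * (⟪v, a⟫ * ⟪v, b⟫)) s := h3.mul (ha.mul hb)
  have htan : ContDiffOn ℝ n (fun v : V ↦ K v (radialProj v a) (radialProj v b)) s :=
    (hK.clm_apply ((contDiffOn_radialProj_apply a).mono hs)).clm_apply
      ((contDiffOn_radialProj_apply b).mono hs)
  refine (hrad.add htan).congr fun v _ ↦ ?_
  exact polarBilin_apply K v a b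

set_option maxHeartbeats 800000 in
/-- **The polar metric of the surgery.** Let `0 < δ ≤ 1/4` and let `B` be a field of bilinear
forms on `V`, `C^∞`, symmetric and positive definite on the ball `B(0, 1+δ)`, and radial on the
collar: `B_v(v, v) = ‖v‖²`, `B_v(v, β) = 0` for `β ⊥ v`, `1-δ ≤ ‖v‖ < 1+δ`. Then there is a field
`P`, `C^∞`, symmetric and positive definite on the ball, radial at every point of the ball, equal
to `B` on the collar and to the inner product on `B(0, 1/2)`.
[cite: Weinstein1968, proof of the main theorem, step (3)] -/
theorem exists_surgeryPolarMetric {B : V → V →L[ℝ] V →L[ℝ] ℝ} {δ : ℝ} (hδ : 0 < δ) (hδ1 : δ ≤ 1 / 4)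
    (hBs : ContDiffOn ℝ ∞ B (ball (0 : V) (1 + δ)))
    (hBsymm : ∀ v ∈ ball (0 : V) (1 + δ), ∀ a b : V, B v a b = B v b a)
    (hBpos : ∀ v ∈ ball (0 : V) (1 + δ), ∀ a : V, a ≠ 0 → 0 < B v a a)
    (hBrad : ∀ v : V, 1 - δ ≤ ‖v‖ → ‖v‖ < 1 + δ →
      B v v v = ‖v‖ ^ 2 ∧ ∀ β : V, ⟪v, β⟫ = 0 → B v v β = 0) :
    ∃ P : V → V →L[ℝ] V →L[ℝ] ℝ,
      ContDiffOn ℝ ∞ P (ball (0 : V) (1 + δ)) ∧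
      (∀ v ∈ ball (0 : V) (1 + δ), ∀ a b : V, P v a b = P v b a) ∧
      (∀ v ∈ ball (0 : V) (1 + δ), ∀ a : V, a ≠ 0 → 0 < P v a a) ∧
      (∀ v ∈ ball (0 : V) (1 + δ), v ≠ 0 → P v v v = ‖v‖ ^ 2) ∧
      (∀ v ∈ ball (0 : V) (1 + δ), v ≠ 0 → ∀ β : V, ⟪v, β⟫ = 0 → P v v β = 0) ∧
      (∀ v : V, 1 - δ ≤ ‖v‖ → ‖v‖ < 1 + δ → P v = B v) ∧
      (∀ v : V, ‖v‖ ≤ 1 / 2 → P v = innerSL ℝ) := by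
  -- the radial cut-off `χ₂(ρ) = smoothTransition ((ρ - (1 - 2δ))/δ)`
  set χ₂ : ℝ → ℝ := fun ρ ↦ smoothTransition ((ρ - (1 - 2 * δ)) / δ) with hχ₂
  have hχ₂0 : ∀ ρ, ρ ≤ 1 - 2 * δ → χ₂ ρ = 0 := fun ρ hρ ↦
    smoothTransition.zero_of_nonpos (div_nonpos_of_nonpos_of_nonneg (by linarith) hδ.le)
  have hχ₂1 : ∀ ρ, 1 - δ ≤ ρ → χ₂ ρ = 1 := fun ρ hρ ↦
    smoothTransition.one_of_one_le ((one_le_div hδ).2 (by linarith))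
  have hχ₂01 : ∀ ρ, 0 ≤ χ₂ ρ ∧ χ₂ ρ ≤ 1 := fun ρ ↦ ⟨smoothTransition.nonneg _, smoothTransition.le_one _⟩
  have hχ₂s : ContDiff ℝ ∞ χ₂ :=
    smoothTransition.contDiff.comp ((contDiff_id.sub contDiff_const).div_const _)
  -- the tangential part
  set IP : V →L[ℝ] V →L[ℝ] ℝ := innerSL ℝ with hIP
  set K : V → V →L[ℝ] V →L[ℝ] ℝ := fun v ↦ χ₂ ‖v‖ • B v + (1 - χ₂ ‖v‖) • IP with hK
  have hKapply : ∀ v a b : V, K v a b = χ₂ ‖v‖ * B v a b + (1 - χ₂ ‖v‖) * ⟪a, b⟫ := by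
    intro v a b
    show (χ₂ ‖v‖ • B v + (1 - χ₂ ‖v‖) • IP) a b = _
    rfl
  have hKcollar : ∀ v : V, 1 - δ ≤ ‖v‖ → K v = B v := by
    intro v hv
    ext a b
    rw [hKapply, hχ₂1 ‖v‖ hv]
    ring
  have hKin : ∀ v : V, ‖v‖ ≤ 1 - 2 * δ → K v = innerSL ℝ := by
    intro v hv
    ext a b
    rw [hKapply, hχ₂0 ‖v‖ hv]
    simp only [zero_mul, zero_add, sub_zero, one_mul]
    rfl
  have hKsymm : ∀ v ∈ ball (0 : V) (1 + δ), ∀ a b : V, K v a b = K v b a := by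
    intro v hv a b; rw [hKapply, hKapply, hBsymm v hv, real_inner_comm]
  have hKpos : ∀ v ∈ ball (0 : V) (1 + δ), ∀ a : V, a ≠ 0 → 0 < K v a a := by
    intro v hv a ha
    rw [hKapply, real_inner_self_eq_norm_sq]
    have h1 := hBpos v hv a ha
    have h2 : 0 < ‖a‖ ^ 2 := by positivity
    obtain ⟨h3, h4⟩ := hχ₂01 ‖v‖
    rcases eq_or_lt_of_le h3 with h | h
    · rw [← h]; linarith
    · nlinarith
  -- smoothness of `K` on the punctured ball (entrywise)
  have hKs : ContDiffOn ℝ ∞ K (ball (0 : V) (1 + δ) ∩ {v | v ≠ 0}) := by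
    have hn : ContDiffOn ℝ ∞ (fun v : V ↦ χ₂ ‖v‖) (ball (0 : V) (1 + δ) ∩ {v | v ≠ 0}) := by
      intro v hv
      exact (hχ₂s.contDiffAt.comp v (contDiffAt_norm ℝ hv.2)).contDiffWithinAt
    rw [contDiffOn_clm_apply]
    intro a
    rw [contDiffOn_clm_apply]
    intro b
    have hB' : ContDiffOn ℝ ∞ (fun v : V ↦ B v a b) (ball (0 : V) (1 + δ) ∩ {v | v ≠ 0}) :=
      ((hBs.mono inter_subset_left).clm_apply contDiffOn_const).clm_apply contDiffOn_const
    have h : ContDiffOn ℝ ∞ (fun v : V ↦ χ₂ ‖v‖ * B v a b + (1 - χ₂ ‖v‖) * ⟪a, b⟫)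
        (ball (0 : V) (1 + δ) ∩ {v | v ≠ 0}) :=
      (hn.mul hB').add ((contDiffOn_const.sub hn).mul contDiffOn_const)
    exact h.congr fun v _ ↦ hKapply v a b
  -- the polar field
  set P : V → V →L[ℝ] V →L[ℝ] ℝ := polarBilin K with hP
  have hPin : ∀ v : V, ‖v‖ ≤ 1 / 2 → P v = innerSL ℝ := by
    intro v hv
    exact polarBilin_const_innerSL K (hKin v (by linarith))
  refine ⟨P, ?_, ?_, ?_, ?_, ?_, ?_, hPin⟩
  · -- smoothness: near `0` constant, elsewhere `contDiffOn_polarBilin_of_subset`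
    intro v hv
    by_cases hsmall : ‖v‖ < 1 / 2
    · have hev : P =ᶠ[𝓝 v] fun _ ↦ (innerSL ℝ : V →L[ℝ] V →L[ℝ] ℝ) := by
        have hopen : IsOpen {x : V | ‖x‖ < 1 / 2} := isOpen_lt continuous_norm continuous_const
        filter_upwards [hopen.mem_nhds hsmall] with x hx
        exact hPin x (le_of_lt hx)
      exact (contDiffAt_const.congr_of_eventuallyEq hev).contDiffWithinAt
    · have hv0 : v ≠ 0 := by
        intro h; rw [h, norm_zero] at hsmall; exact hsmall (by norm_num)
      have hopen : IsOpen (ball (0 : V) (1 + δ) ∩ {v | v ≠ 0}) := isOpen_ball.inter isOpen_ne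
      have h := (contDiffOn_polarBilin_of_subset inter_subset_right hKs).contDiffAt
        (hopen.mem_nhds ⟨hv, hv0⟩)
      exact h.contDiffWithinAt
  · intro v hv a b
    exact polarBilin_symm K (hKsymm v hv) a b
  · intro v hv a ha
    exact polarBilin_pos K (hKpos v hv) ha
  · intro v _ hv0
    exact polarBilin_apply_self_self K hv0
  · intro v _ hv0 β hβ
    exact polarBilin_apply_self_of_inner_eq_zero K hv0 hβ
  · intro v h1 h2
    have hv0 : v ≠ 0 := by
      intro h; rw [h, norm_zero] at h1; linarith
    have hvb : v ∈ ball (0 : V) (1 + δ) := by rwa [mem_ball_zero_iff]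
    obtain ⟨hvv, hvβ⟩ := hBrad v h1 h2
    refine polarBilin_eq_of_isRadialAt K hv0 (hKcollar v h1) hvv hvβ ?_
    intro β hβ
    rw [hBsymm v hvb, hvβ β hβ]

end Literature.Geometry.Riemannian

end
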